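import Mathlib
import HarnessLib
import Summits.NavierStokesRegularity.NavierStokesRegularity.Theorems.UnthreadedRigidityDoorUnthreadedRigidityPersistenceCubicLaw

/-!
# Route `UnthreadedRigidityDoor`, item `UnthreadedRigidity` (W2, stmt-NavierStokesRegularity-27585) — LINE g12-2 «PERSISTENCE» / g12-1 «CO-ZONAL»:
# THE POWER LAW `K^{L+1} = C·H^{L−1}` AND THE FIRST INTEGRAL of the balance `b_L[H] ≡ 0`, EVERY DEGREE

Prover file (engine-1 g74; `--supports stmt-NavierStokesRegularity-27585 --as helper`; route-independent imports).

What the CONSECUTIVE two-shell window rungs `TwoShellWindowRigidity l (l+1)` still need (HOME engine/engine-1/RECORD-OF-CUSTODY-engine1-g74.md §3(a)):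
by `MixedPair.twoShell_sphere_coefficients` (p732222) the top shell of ANY opposite-parity two-shell window has `b_L[H] ≡ 0` on `(0,∞)`,
`b_L[H] = (L/2r)((L−1)K H′ − (L+1)K′H)`, `K = K_L[H] = H″ + 2(L+1)H′/r` (`VirialHorn.vortAmpL`).  This file records, for EVERY degree, the two
consequences of `b_L ≡ 0` that es-p1's `Persistence.cubicLaw` / `…CubicLawNonexistence` used at `L = 2`:

* ★ `powerLaw` — the generalised CUBIC LAW: for an admissible profile analytic on `(0,∞)` with `b_{m+2} ≡ 0`, ONE constant `C` gives
  `K^{m+3} = C·H^{m+1}` on `(0,∞)` (the quotient `K^{L+1}/H^{L−1}` has zero derivative where `H ≠ 0`; identity theorem; `L = m + 2`);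
* ★ `hasDerivAt_firstIntegral` — the FIRST INTEGRAL: with `E := L·H′² − (L+1)·K·H`, `b_L ≡ 0` alone gives `E′ = −4L(L+1)H′²/r` (`L ≥ 1`;
  es-p1's `H′²/2 − 3K⁴/(4C)` is `E/4` at `L = 2`, `K³ = CH`), and `hasDerivAt_weighted_firstIntegral`:
  `(r^{4(L+1)}E)′ = −4(L+1)²·r^{4L+3}·K·H` (es-p1's `(r¹²E)′ = −9r¹¹K⁴/C`, times `4`).
* ★ `eq_zero_of_bL_eq_zero_of_nonneg` — the SIGN-DEFINITE BRANCH of the nonexistence, every degree `L ≥ 1`: `b_L ≡ 0` and `K·H ≥ 0` on `(0,∞)`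
  force `H ≡ 0` (es-p1's `cubicLaw_pos_case` argument verbatim with the first integral: `E ↓ 0` at `∞` by the decay `decay_profile`, `r^{4(L+1)}E ↓`
  from `0` at `0⁺` since `E ≤ L·H′²` and `H′(s) = 2s·h′(s²)` is bounded; so `E ≡ 0`, `H′ ≡ 0`, `K ≡ 0`, `ThreadingJets.eq_zero_of_vortAmpL_eq_zero`);
  `eq_zero_of_bL_eq_zero_even_of_nonneg_const` — for EVEN `L` the power law with `C ≥ 0` gives `KH ≥ 0` (odd exponents), hence `H ≡ 0`.
WHAT STAYS OPEN of the nonexistence (es-p1's `cubicLawNonexistence` is `L = 2`, both signs): EVEN `L ≥ 4` with `C < 0` (`KH ≤ 0`; es-p1's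
mean-value decay step needs sharper bookkeeping for large `L`), and ODD `L ≥ 3` (even exponents: no sign information from the power law).

HONEST LABEL: elementary ODE identities (support of a rung line); nothing here bears on `UnthreadedRigidity` (27585), the door Target, W2 or Navier–Stokes
regularity; no summit statement is proved.  MODEL/rung work; 0 kit.  [folklore]
-/

noncomputable section

-- the summit and its single sub-problem share the name (CONVENTIONS §1), as in every Theorems file
set_option linter.dupNamespace false

namespace Summit.NavierStokesRegularity.NavierStokesRegularity.Theorems.UnthreadedRigidity.MixedPair

open Set Function Filter Topology
open Summit.NavierStokesRegularity.NavierStokesRegularity.Theorems.UnthreadedRigidity.VirialHorn (VirialAdmissible vortAmpL strainAmpL)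
open Summit.NavierStokesRegularity.NavierStokesRegularity.Theorems.UnthreadedRigidity.ThreadingJets (analyticOnNhd_vortAmpL
  virialAdmissible_hasDerivAt_of_pos eq_zero_of_vortAmpL_eq_zero)
open Summit.NavierStokesRegularity.NavierStokesRegularity.Theorems.UnthreadedRigidity.Persistence (vortAmpL_eq_zero_of_eq_zero)

/-- the balance `b_L = 0` at `r > 0`, solved: `(L−1) K H′ = (L+1) K′ H`. -/
theorem balance_eq_of_bL_eq_zero {L : ℕ} (hL : 1 ≤ L) {H : ℝ → ℝ} {r : ℝ} (hr : 0 < r)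
    (hb : (L : ℝ) / (2 * r) * (((L : ℝ) - 1) * vortAmpL L H r * deriv H r - ((L : ℝ) + 1) * deriv (vortAmpL L H) r * H r) = 0) :
    ((L : ℝ) - 1) * vortAmpL L H r * deriv H r = ((L : ℝ) + 1) * deriv (vortAmpL L H) r * H r := by
  have hc : (L : ℝ) / (2 * r) ≠ 0 := div_ne_zero (by exact_mod_cast (show L ≠ 0 by omega)) (by positivity)
  have h2 := (mul_eq_zero.1 hb).resolve_left hc
  linarith

/-- ★ **THE POWER LAW** (generalised cubic law): `b_{m+2}[H] ≡ 0` on `(0,∞)` for an admissible analytic profile of degree `L = m + 2` gives ONE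
constant `C` with `K^{m+3} = C·H^{m+1}` on `(0,∞)`. [folklore] -/
theorem powerLaw (m : ℕ) :
    ∀ (H : ℝ → ℝ), VirialAdmissible (m + 2) H → AnalyticOnNhd ℝ H (Set.Ioi 0) →
      (∀ r : ℝ, 0 < r →
        (((m + 2 : ℕ) : ℝ)) / (2 * r) * (((((m + 2 : ℕ) : ℝ)) - 1) * vortAmpL (m + 2) H r * deriv H r -
          ((((m + 2 : ℕ) : ℝ)) + 1) * deriv (vortAmpL (m + 2) H) r * H r) = 0) →
      ∃ C : ℝ, ∀ r : ℝ, 0 < r → vortAmpL (m + 2) H r ^ (m + 3) = C * H r ^ (m + 1) := by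
  intro H _ hHa hb
  set K : ℝ → ℝ := vortAmpL (m + 2) H with hKdef
  -- the balance: `(m+1) K H′ = (m+3) K′ H` on `(0,∞)`
  have hbal : ∀ r : ℝ, 0 < r → ((m : ℝ) + 1) * K r * deriv H r = ((m : ℝ) + 3) * deriv K r * H r := by
    intro r hr
    have h := balance_eq_of_bL_eq_zero (L := m + 2) (by omega) hr (hb r hr)
    push_cast at h
    rw [hKdef]
    linarith
  have hK : AnalyticOnNhd ℝ K (Ioi 0) := analyticOnNhd_vortAmpL hHa
  by_cases hHz : ∀ r : ℝ, 0 < r → H r = 0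
  · exact ⟨0, fun r hr => by rw [hKdef, vortAmpL_eq_zero_of_eq_zero hHz hr, hHz r hr]; simp⟩
  push Not at hHz
  obtain ⟨r₀, hr₀, hH0⟩ := hHz
  set C : ℝ := K r₀ ^ (m + 3) / H r₀ ^ (m + 1) with hC
  refine ⟨C, ?_⟩
  set F : ℝ → ℝ := fun r => K r ^ (m + 3) - C * H r ^ (m + 1) with hF
  have hFa : AnalyticOnNhd ℝ F (Ioi 0) := fun r hr => ((hK r hr).pow (m + 3)).sub (analyticAt_const.mul ((hHa r hr).pow (m + 1)))
  have hne : ∀ᶠ r in 𝓝 r₀, H r ≠ 0 ∧ 0 < r :=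
    ((hHa r₀ hr₀).continuousAt.eventually_ne hH0).and (Ioi_mem_nhds hr₀)
  obtain ⟨ε, hε, hball⟩ := Metric.eventually_nhds_iff.1 hne
  -- on the ball the quotient `Q = K^{m+3}/H^{m+1}` has zero derivative
  set Q : ℝ → ℝ := fun r => K r ^ (m + 3) / H r ^ (m + 1) with hQ
  have hQd : ∀ r, dist r r₀ < ε → HasDerivAt Q 0 r := by
    intro r hr
    obtain ⟨hHr, hr0⟩ := hball hr
    have hKd : HasDerivAt K (deriv K r) r := (hK r hr0).differentiableAt.hasDerivAt
    have hHd : HasDerivAt H (deriv H r) r := (hHa r hr0).differentiableAt.hasDerivAt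
    have hKp : HasDerivAt (fun s => K s ^ (m + 3)) (((m + 3 : ℕ) : ℝ) * K r ^ (m + 2) * deriv K r) r := by
      simpa using hKd.fun_pow (m + 3)
    have hHp : HasDerivAt (fun s => H s ^ (m + 1)) (((m + 1 : ℕ) : ℝ) * H r ^ m * deriv H r) r := by
      simpa using hHd.fun_pow (m + 1)
    have hdiv := hKp.div hHp (pow_ne_zero _ hHr)
    have e : (((m + 3 : ℕ) : ℝ) * K r ^ (m + 2) * deriv K r * H r ^ (m + 1)
        - K r ^ (m + 3) * (((m + 1 : ℕ) : ℝ) * H r ^ m * deriv H r)) / (H r ^ (m + 1)) ^ 2 = 0 := by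
      rw [div_eq_zero_iff]
      left
      have h1 := hbal r hr0
      have e1 : ((m + 3 : ℕ) : ℝ) * K r ^ (m + 2) * deriv K r * H r ^ (m + 1) - K r ^ (m + 3) * (((m + 1 : ℕ) : ℝ) * H r ^ m * deriv H r)
          = K r ^ (m + 2) * H r ^ m * (((m : ℝ) + 3) * deriv K r * H r - ((m : ℝ) + 1) * K r * deriv H r) := by
        push_cast; ring
      rw [e1, ← h1]; ring
    rw [e] at hdiv
    exact hdiv
  have hQdiff : DifferentiableOn ℝ Q (Metric.ball r₀ ε) := fun r hr =>
    (hQd r (Metric.mem_ball.1 hr)).differentiableAt.differentiableWithinAt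
  have hQconst : ∀ r ∈ Metric.ball r₀ ε, Q r = Q r₀ := fun r hr =>
    Metric.isOpen_ball.is_const_of_deriv_eq_zero (convex_ball r₀ ε).isPreconnected hQdiff
      (fun x hx => (hQd x (Metric.mem_ball.1 hx)).deriv) hr (Metric.mem_ball_self hε)
  have hF0 : F =ᶠ[𝓝 r₀] 0 := by
    filter_upwards [Metric.ball_mem_nhds r₀ hε] with r hr
    obtain ⟨hHr, -⟩ := hball (Metric.mem_ball.1 hr)
    have h1 : Q r = C := by rw [hQconst r hr]
    simp only [hF, Pi.zero_apply]
    rw [← h1, hQ]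
    field_simp
    ring
  have hFzero := hFa.eqOn_zero_of_preconnected_of_eventuallyEq_zero (convex_Ioi (0 : ℝ)).isPreconnected hr₀ hF0
  intro r hr
  have h := hFzero hr
  simp only [hF, Pi.zero_apply] at h
  rw [hKdef] at h
  linarith

/-- ★ **THE FIRST INTEGRAL of `b_L ≡ 0`** (every degree `L ≥ 1`): at `r > 0`, for `H` analytic on `(0,∞)` with `b_L[H](r) = 0`,
`E := L·H′² − (L+1)·K·H` has `E′(r) = −4L(L+1)H′(r)²/r` (`K = H″ + 2(L+1)H′/r`; only the balance AT `r` is used; es-p1's energy at `L = 2` is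
`E/4`). [folklore] -/
theorem hasDerivAt_firstIntegral {L : ℕ} (hL : 1 ≤ L) {H : ℝ → ℝ} (hHa : AnalyticOnNhd ℝ H (Set.Ioi 0)) {r : ℝ} (hr : 0 < r)
    (hb : (L : ℝ) / (2 * r) * (((L : ℝ) - 1) * vortAmpL L H r * deriv H r - ((L : ℝ) + 1) * deriv (vortAmpL L H) r * H r) = 0) :
    HasDerivAt (fun s => (L : ℝ) * deriv H s ^ 2 - ((L : ℝ) + 1) * (vortAmpL L H s * H s))
      (-(4 * (L : ℝ) * ((L : ℝ) + 1)) * deriv H r ^ 2 / r) r := by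
  have hbal := balance_eq_of_bL_eq_zero hL hr hb
  have hK : AnalyticOnNhd ℝ (vortAmpL L H) (Ioi 0) := analyticOnNhd_vortAmpL hHa
  have hHd : HasDerivAt H (deriv H r) r := (hHa r hr).differentiableAt.hasDerivAt
  have hH1 : HasDerivAt (deriv H) (deriv (deriv H) r) r := ((hHa.deriv) r hr).differentiableAt.hasDerivAt
  have hKd : HasDerivAt (vortAmpL L H) (deriv (vortAmpL L H) r) r := (hK r hr).differentiableAt.hasDerivAt
  -- `H″ = K − 2(L+1)H′/r`
  have hH2 : deriv (deriv H) r = vortAmpL L H r - 2 * ((L : ℝ) + 1) / r * deriv H r := by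
    simp only [vortAmpL]; ring
  have hE : HasDerivAt (fun s => (L : ℝ) * deriv H s ^ 2 - ((L : ℝ) + 1) * (vortAmpL L H s * H s))
      ((L : ℝ) * ((2 : ℕ) * deriv H r ^ (2 - 1) * deriv (deriv H) r)
        - ((L : ℝ) + 1) * (deriv (vortAmpL L H) r * H r + vortAmpL L H r * deriv H r)) r :=
    ((hH1.fun_pow 2).const_mul (L : ℝ)).sub ((hKd.mul hHd).const_mul ((L : ℝ) + 1))
  refine hE.congr_deriv ?_
  simp only [Nat.cast_ofNat, Nat.add_one_sub_one, pow_one]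
  linear_combination hbal + (2 * (L : ℝ) * deriv H r) * hH2

/-- ★ THE WEIGHTED FIRST INTEGRAL: `(r^{4(L+1)}·E)′ = −4(L+1)²·r^{4L+3}·K·H` at every `r > 0` with `b_L[H](r) = 0`
(`E = L·H′² − (L+1)·K·H`; es-p1's `(r¹²E)′ = −9r¹¹K⁴/C` at `L = 2` up to the factor `4`). [folklore] -/
theorem hasDerivAt_weighted_firstIntegral {L : ℕ} (hL : 1 ≤ L) {H : ℝ → ℝ} (hHa : AnalyticOnNhd ℝ H (Set.Ioi 0)) {r : ℝ} (hr : 0 < r)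
    (hb : (L : ℝ) / (2 * r) * (((L : ℝ) - 1) * vortAmpL L H r * deriv H r - ((L : ℝ) + 1) * deriv (vortAmpL L H) r * H r) = 0) :
    HasDerivAt (fun s => s ^ (4 * (L + 1)) * ((L : ℝ) * deriv H s ^ 2 - ((L : ℝ) + 1) * (vortAmpL L H s * H s)))
      (-(4 * ((L : ℝ) + 1) ^ 2) * r ^ (4 * L + 3) * (vortAmpL L H r * H r)) r := by
  have hE := hasDerivAt_firstIntegral hL hHa hr hb
  have hpow : HasDerivAt (fun s : ℝ => s ^ (4 * (L + 1))) (((4 * (L + 1) : ℕ) : ℝ) * r ^ (4 * (L + 1) - 1)) r := by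
    simpa using hasDerivAt_pow (4 * (L + 1)) r
  have h : HasDerivAt (fun s => s ^ (4 * (L + 1)) * ((L : ℝ) * deriv H s ^ 2 - ((L : ℝ) + 1) * (vortAmpL L H s * H s)))
      (((4 * (L + 1) : ℕ) : ℝ) * r ^ (4 * (L + 1) - 1) * ((L : ℝ) * deriv H r ^ 2 - ((L : ℝ) + 1) * (vortAmpL L H r * H r))
        + r ^ (4 * (L + 1)) * (-(4 * (L : ℝ) * ((L : ℝ) + 1)) * deriv H r ^ 2 / r)) r := hpow.mul hE
  refine h.congr_deriv ?_
  rw [show 4 * (L + 1) - 1 = 4 * L + 3 by omega, show 4 * (L + 1) = (4 * L + 3) + 1 by omega, pow_succ]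
  push_cast
  field_simp
  ring

/-! ## The sign-definite branch of the nonexistence: `K·H ≥ 0` -/

/-- DECAY of a degree-`L` admissible profile on `[1,∞)`: `|H| ≤ M r^{−(L+2)}`, `|H′| ≤ M r^{−(L+3)}`, `|K_L[H]| ≤ M r^{−(L+4)}` (`M = (2L+3)C₁`). -/
theorem decay_profile {L : ℕ} {H : ℝ → ℝ} (hH : VirialAdmissible L H) :
    ∃ M : ℝ, 0 ≤ M ∧ ∀ r : ℝ, 1 ≤ r →
      |H r| ≤ M / r ^ (L + 2) ∧ |deriv H r| ≤ M / r ^ (L + 3) ∧ |vortAmpL L H r| ≤ M / r ^ (L + 4) := by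
  obtain ⟨C, hC⟩ := hH.2
  have hC0 : 0 ≤ C := by
    obtain ⟨h0, -, -⟩ := hC 1 le_rfl
    exact le_trans (by positivity) h0
  refine ⟨(2 * L + 3) * C, by positivity, fun r hr => ?_⟩
  obtain ⟨h0, h1, h2⟩ := hC r hr
  have hr0 : 0 < r := lt_of_lt_of_le one_pos hr
  have hH0 : |H r| ≤ C / r ^ (L + 2) := by rw [le_div_iff₀ (by positivity)]; linarith [h0]
  have hH1 : |deriv H r| ≤ C / r ^ (L + 3) := by rw [le_div_iff₀ (by positivity)]; linarith [h1]
  have hH2 : |deriv (deriv H) r| ≤ C / r ^ (L + 4) := by rw [le_div_iff₀ (by positivity)]; linarith [h2]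
  have hC1 : C ≤ (2 * L + 3) * C := by nlinarith
  refine ⟨hH0.trans (by gcongr), hH1.trans (by gcongr), ?_⟩
  unfold vortAmpL
  have hL1 : 0 < 2 * ((L : ℝ) + 1) := by positivity
  calc |deriv (deriv H) r + 2 * ((L : ℝ) + 1) / r * deriv H r|
      ≤ |deriv (deriv H) r| + |2 * ((L : ℝ) + 1) / r * deriv H r| := abs_add_le _ _
    _ = |deriv (deriv H) r| + 2 * ((L : ℝ) + 1) / r * |deriv H r| := by
        rw [abs_mul, abs_div, abs_of_pos hr0, abs_of_pos hL1]
    _ ≤ C / r ^ (L + 4) + 2 * ((L : ℝ) + 1) / r * (C / r ^ (L + 3)) := by gcongr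
    _ = (2 * L + 3) * C / r ^ (L + 4) := by field_simp; ring

/-- ★ **NO ADMISSIBLE PROFILE WITH `b_L ≡ 0` AND `K·H ≥ 0`** (every degree `L ≥ 1`; es-p1's `cubicLaw_pos_case` is `L = 2`, `K³ = CH`, `C > 0`):
`E = L·H′² − (L+1)KH` is non-increasing and tends to `0` at infinity (decay), so `E ≥ 0`; `r^{4(L+1)}E` is non-increasing and `O(r^{4(L+1)})` at
`0⁺` (`E ≤ L·H′²`, `H′(s) = 2s·h′(s²)` bounded), so `E ≤ 0`; hence `E′ ≡ 0`, `H′ ≡ 0`, `K ≡ 0`, `H ≡ 0`. [folklore] -/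
theorem eq_zero_of_bL_eq_zero_of_nonneg {L : ℕ} (hL : 1 ≤ L) {H : ℝ → ℝ} (hH : VirialAdmissible L H) (hHa : AnalyticOnNhd ℝ H (Set.Ioi 0))
    (hb : ∀ r : ℝ, 0 < r →
      (L : ℝ) / (2 * r) * (((L : ℝ) - 1) * vortAmpL L H r * deriv H r - ((L : ℝ) + 1) * deriv (vortAmpL L H) r * H r) = 0)
    (hsign : ∀ r : ℝ, 0 < r → 0 ≤ vortAmpL L H r * H r) : ∀ r : ℝ, 0 < r → H r = 0 := by
  set E : ℝ → ℝ := fun s => (L : ℝ) * deriv H s ^ 2 - ((L : ℝ) + 1) * (vortAmpL L H s * H s) with hE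
  have hEd : ∀ r, 0 < r → HasDerivAt E (-(4 * (L : ℝ) * ((L : ℝ) + 1)) * deriv H r ^ 2 / r) r :=
    fun r hr => hasDerivAt_firstIntegral hL hHa hr (hb r hr)
  have hWd : ∀ r, 0 < r → HasDerivAt (fun s => s ^ (4 * (L + 1)) * E s)
      (-(4 * ((L : ℝ) + 1) ^ 2) * r ^ (4 * L + 3) * (vortAmpL L H r * H r)) r :=
    fun r hr => hasDerivAt_weighted_firstIntegral hL hHa hr (hb r hr)
  -- `E` and `r^{4(L+1)} E` are non-increasing on `(0,∞)`
  have hEanti : AntitoneOn E (Ioi 0) := by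
    apply antitoneOn_of_deriv_nonpos (convex_Ioi 0)
    · exact fun r hr => (hEd r hr).continuousAt.continuousWithinAt
    · rw [interior_Ioi]; exact fun r hr => (hEd r hr).differentiableAt.differentiableWithinAt
    · rw [interior_Ioi]; intro r hr
      have hr' : 0 < r := hr
      rw [(hEd r hr').deriv]
      have : 0 ≤ 4 * (L : ℝ) * ((L : ℝ) + 1) * deriv H r ^ 2 / r := by positivity
      rw [neg_mul, neg_div]
      linarith
  have hWanti : AntitoneOn (fun s => s ^ (4 * (L + 1)) * E s) (Ioi 0) := by
    apply antitoneOn_of_deriv_nonpos (convex_Ioi 0)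
    · exact fun r hr => (hWd r hr).continuousAt.continuousWithinAt
    · rw [interior_Ioi]; exact fun r hr => (hWd r hr).differentiableAt.differentiableWithinAt
    · rw [interior_Ioi]; intro r hr
      have hr' : 0 < r := hr
      rw [(hWd r hr').deriv]
      have : 0 ≤ 4 * ((L : ℝ) + 1) ^ 2 * r ^ (4 * L + 3) * (vortAmpL L H r * H r) := by
        have := hsign r hr'; positivity
      linarith
  obtain ⟨M, hM0, hM⟩ := decay_profile hH
  -- `E ≥ 0`: `E r ≥ E s ≥ −(L+1)|K(s)H(s)| ≥ −((L+1)M²)/s` for `s ≥ max r 1`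
  have hEnn : ∀ r, 0 < r → 0 ≤ E r := by
    intro r hr
    have hlim : Tendsto (fun s : ℝ => -(((L : ℝ) + 1) * M ^ 2) / s) atTop (𝓝 0) := tendsto_const_nhds.div_atTop tendsto_id
    refine le_of_tendsto_of_tendsto hlim tendsto_const_nhds ?_
    filter_upwards [eventually_ge_atTop (max r 1)] with s hs
    have hs1 : 1 ≤ s := le_trans (le_max_right _ _) hs
    have hrs : r ≤ s := le_trans (le_max_left _ _) hs
    have hs0 : 0 < s := lt_of_lt_of_le one_pos hs1
    have h1 : E s ≤ E r := hEanti (mem_Ioi.2 hr) (mem_Ioi.2 hs0) hrs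
    obtain ⟨hHs, -, hKs⟩ := hM s hs1
    have hKH : |vortAmpL L H s * H s| ≤ M ^ 2 / s := by
      rw [abs_mul]
      calc |vortAmpL L H s| * |H s| ≤ M / s ^ (L + 4) * (M / s ^ (L + 2)) :=
            mul_le_mul hKs hHs (abs_nonneg _) (by positivity)
        _ = M ^ 2 / s ^ (2 * L + 6) := by rw [div_mul_div_comm, ← pow_add]; ring_nf
        _ ≤ M ^ 2 / s := by
            apply div_le_div_of_nonneg_left (by positivity) hs0
            calc s = s ^ 1 := (pow_one s).symm
              _ ≤ s ^ (2 * L + 6) := pow_le_pow_right₀ hs1 (by omega)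
    have h2 : -(((L : ℝ) + 1) * M ^ 2) / s ≤ E s := by
      have h3 : ((L : ℝ) + 1) * (vortAmpL L H s * H s) ≤ ((L : ℝ) + 1) * (M ^ 2 / s) :=
        mul_le_mul_of_nonneg_left ((le_abs_self _).trans hKH) (by positivity)
      have h4 : 0 ≤ (L : ℝ) * deriv H s ^ 2 := by positivity
      have h5 : -(((L : ℝ) + 1) * M ^ 2) / s = -(((L : ℝ) + 1) * (M ^ 2 / s)) := by ring
      rw [h5]
      show -(((L : ℝ) + 1) * (M ^ 2 / s)) ≤ (L : ℝ) * deriv H s ^ 2 - ((L : ℝ) + 1) * (vortAmpL L H s * H s)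
      linarith
    exact h2.trans h1
  -- `E ≤ 0`: `r^{4(L+1)}E r ≤ s^{4(L+1)}E s ≤ s^{4(L+1)}·L·B²` for `0 < s ≤ r`
  obtain ⟨h, hh, -, hder⟩ := virialAdmissible_hasDerivAt_of_pos hH
  have hEnp : ∀ r, 0 < r → E r ≤ 0 := by
    intro r hr
    have hcont : ContinuousOn (fun s : ℝ => 2 * s * deriv h (s ^ 2)) (Icc 0 r) := by
      have h1 : ContDiff ℝ (⊤ : ℕ∞) (deriv h) := hh.deriv'
      exact ((continuous_const.mul continuous_id).mul (h1.continuous.comp (continuous_pow 2))).continuousOn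
    obtain ⟨B, hB⟩ := isCompact_Icc.exists_bound_of_continuousOn hcont
    have hkey : ∀ s, 0 < s → s ≤ r → r ^ (4 * (L + 1)) * E r ≤ (L : ℝ) * B ^ 2 * s ^ (4 * (L + 1)) := by
      intro s hs hsr
      have h1 : r ^ (4 * (L + 1)) * E r ≤ s ^ (4 * (L + 1)) * E s := hWanti (mem_Ioi.2 hs) (mem_Ioi.2 hr) hsr
      have h2 : E s ≤ (L : ℝ) * B ^ 2 := by
        have h3 : |deriv H s| ≤ B := by
          have h4 := hB s ⟨hs.le, hsr⟩
          rw [Real.norm_eq_abs] at h4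
          rwa [(hder s hs).deriv]
        have h4 : deriv H s ^ 2 ≤ B ^ 2 := by
          rw [← sq_abs]; exact pow_le_pow_left₀ (abs_nonneg _) h3 2
        have h5 : 0 ≤ ((L : ℝ) + 1) * (vortAmpL L H s * H s) := by have := hsign s hs; positivity
        have h6 : (L : ℝ) * deriv H s ^ 2 ≤ (L : ℝ) * B ^ 2 := mul_le_mul_of_nonneg_left h4 (by positivity)
        show (L : ℝ) * deriv H s ^ 2 - ((L : ℝ) + 1) * (vortAmpL L H s * H s) ≤ (L : ℝ) * B ^ 2
        linarith
      calc r ^ (4 * (L + 1)) * E r ≤ s ^ (4 * (L + 1)) * E s := h1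
        _ ≤ s ^ (4 * (L + 1)) * ((L : ℝ) * B ^ 2) := by gcongr
        _ = (L : ℝ) * B ^ 2 * s ^ (4 * (L + 1)) := by ring
    have hlim : Tendsto (fun s : ℝ => (L : ℝ) * B ^ 2 * s ^ (4 * (L + 1))) (𝓝[>] 0) (𝓝 0) := by
      have hc : Continuous fun s : ℝ => (L : ℝ) * B ^ 2 * s ^ (4 * (L + 1)) := continuous_const.mul (continuous_pow _)
      have h1 := hc.tendsto 0
      rw [zero_pow (by omega), mul_zero] at h1
      exact h1.mono_left nhdsWithin_le_nhds
    have h1 : r ^ (4 * (L + 1)) * E r ≤ 0 := by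
      refine le_of_tendsto_of_tendsto tendsto_const_nhds hlim ?_
      filter_upwards [Ioo_mem_nhdsGT hr] with s hs
      exact hkey s hs.1 hs.2.le
    by_contra h3
    push Not at h3
    have : 0 < r ^ (4 * (L + 1)) * E r := mul_pos (by positivity) h3
    linarith
  -- `E ≡ 0`, hence `H′ ≡ 0` on `(0,∞)`, `K ≡ 0`, `H ≡ 0`
  have hE0 : ∀ r, 0 < r → E r = 0 := fun r hr => le_antisymm (hEnp r hr) (hEnn r hr)
  have hH1 : ∀ r, 0 < r → deriv H r = 0 := by
    intro r hr
    have hE0' : E =ᶠ[𝓝 r] fun _ => (0 : ℝ) := by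
      filter_upwards [Ioi_mem_nhds hr] with s hs
      exact hE0 s hs
    have hd : -(4 * (L : ℝ) * ((L : ℝ) + 1)) * deriv H r ^ 2 / r = 0 := by
      rw [← (hEd r hr).deriv, hE0'.deriv_eq, deriv_const]
    have hL0 : (4 * (L : ℝ) * ((L : ℝ) + 1)) ≠ 0 := by positivity
    have h1 : deriv H r ^ 2 = 0 := by
      rcases div_eq_zero_iff.1 hd with h2 | h2
      · exact (mul_eq_zero.1 h2).resolve_left (neg_ne_zero.2 hL0)
      · exact absurd h2 hr.ne'
    exact (pow_eq_zero_iff two_ne_zero).1 h1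
  have hK0 : ∀ r, 0 < r → vortAmpL L H r = 0 := by
    intro r hr
    have h1' : deriv H =ᶠ[𝓝 r] fun _ => (0 : ℝ) := by
      filter_upwards [Ioi_mem_nhds hr] with s hs
      exact hH1 s hs
    have h2 : deriv (deriv H) r = 0 := by rw [h1'.deriv_eq]; simp
    unfold vortAmpL
    rw [h2, hH1 r hr]; ring
  exact fun r hr => (eq_zero_of_vortAmpL_eq_zero hH hK0 r hr).1

/-- ★ COROLLARY (even top degree, positive constant): an admissible analytic profile of EVEN degree `L = 2n+2` with `b_L ≡ 0` whose power-law
constant is `≥ 0` (`K^{L+1} = C·H^{L−1}`, `C ≥ 0`, odd exponents ⇒ `KH ≥ 0`) vanishes.  (The branch `C < 0` is the open one.) [folklore] -/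
theorem eq_zero_of_bL_eq_zero_even_of_nonneg_const (n : ℕ) {H : ℝ → ℝ} (hH : VirialAdmissible (2 * n + 2) H)
    (hHa : AnalyticOnNhd ℝ H (Set.Ioi 0))
    (hb : ∀ r : ℝ, 0 < r →
      (((2 * n + 2 : ℕ) : ℝ)) / (2 * r) * (((((2 * n + 2 : ℕ) : ℝ)) - 1) * vortAmpL (2 * n + 2) H r * deriv H r -
        ((((2 * n + 2 : ℕ) : ℝ)) + 1) * deriv (vortAmpL (2 * n + 2) H) r * H r) = 0)
    {C : ℝ} (hC : 0 ≤ C) (hKC : ∀ r : ℝ, 0 < r → vortAmpL (2 * n + 2) H r ^ (2 * n + 3) = C * H r ^ (2 * n + 1)) :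
    ∀ r : ℝ, 0 < r → H r = 0 := by
  refine eq_zero_of_bL_eq_zero_of_nonneg (L := 2 * n + 2) (by omega) hH hHa (fun r hr => by exact_mod_cast hb r hr) fun r hr => ?_
  -- odd powers carry signs: `K^{2n+3} H^{2n+1}·(KH)… ≥ 0`
  have h := hKC r hr
  set K := vortAmpL (2 * n + 2) H r with hK
  set y := H r with hy
  by_contra hneg
  push Not at hneg
  -- `K y < 0`: then `K^{2n+3} y^{2n+1} = (K y)^{2n+1} K² < 0 ≤ C y^{2n+1} y^{2n+1}`… compare signs via `(K y)^{2n+1}`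
  have hKy : (K * y) ^ (2 * n + 1) < 0 := Odd.pow_neg (by exact ⟨n, by ring⟩) hneg
  have hK2 : 0 < K ^ 2 := by
    rcases eq_or_ne K 0 with h0 | h0
    · rw [h0, zero_mul] at hneg; exact absurd hneg (lt_irrefl 0)
    · positivity
  have e1 : K ^ (2 * n + 3) * y ^ (2 * n + 1) = (K * y) ^ (2 * n + 1) * K ^ 2 := by ring
  have e2 : C * y ^ (2 * n + 1) * y ^ (2 * n + 1) = C * (y ^ (2 * n + 1)) ^ 2 := by ring
  have h1 : K ^ (2 * n + 3) * y ^ (2 * n + 1) = C * y ^ (2 * n + 1) * y ^ (2 * n + 1) := by rw [h]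
  rw [e1, e2] at h1
  have h2 : (K * y) ^ (2 * n + 1) * K ^ 2 < 0 := mul_neg_of_neg_of_pos hKy hK2
  have h3 : 0 ≤ C * (y ^ (2 * n + 1)) ^ 2 := by positivity
  linarith

end Summit.NavierStokesRegularity.NavierStokesRegularity.Theorems.UnthreadedRigidity.MixedPair

end
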